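import Summits.BirchSwinnertonDyer.Rank1Residual.Partition.MainConjecturesEisensteinTwistCertificate
import Literature.NumberTheory.EllipticCurves.CastellaGrossiSkinner2025.MazurMainConjectureRankOne
import HarnessLib

/-!
# Row D4 at `p = 3`: Castella–Grossi–Skinner 2025 Theorem A AT THE PRIME `3` as ONE typed OPEN binder
# (the located GAP(line) of the in-cell referee), and its row-C6 consumers in both ranks

HONEST FRAMING (cell `bsd-litref`, paper sub-dir `cgs25`, `run/shared/lean/pub/bsd-litref/cgs25/`;
programme BSD-LIT2PART v1 §T2 / §HONESTY: no tranche proves BSD; «gapped / unrefereed proofs are REFEREE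
targets»; a GAP is TYPED as a Lean target, never patched by assumption; typed ≠ proved ≠ endorsed).
Nothing in this file is a theorem about any curve at `p = 3` beyond what the binder says: the Mazur main
conjecture AT `p = 3` for good Eisenstein non-anomalous `E/ℚ` enters ONLY as an explicitly labelled OPEN
binder (`…_OPEN : Prop`, `[claim: …, under-review]`, NEVER a theorem); published results are consumed BY
NAME; the consumers are CONDITIONAL on the binder and close nothing. PARTITION (D-0054): row D4 = covered
row C6 (good · odd `p` · reducible · non-anomalous) at `p = 3` — 1 783 CGS-only literal classes
(1 638 of analytic rank `1`, 145 of rank `0`; reader 1's census on referee A's state R303.4) — types the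
object of; closes none; books none. Seat `bsd-litref-cgs25-ty` (typer), 2026-08-26, executing item 6.4 of
the D-audit sheet `pub/bsd-litref/cgs25/sheets/D-AUDIT-cgs25-r1.md` (sha16 cd6b303b333505a2).

## Why this file (the located gap, verbatim from the sheet)

Reader 1's verdict on the PREPRINT node X = CGS25 Thm. 4.1.1 ("proved in [BSTW23, §5]" =
Burungale–Skinner–Tian–Wan arXiv:2409.01350 §5), by prime (sheet §0 / §5.4): **p ∈ {5, 7, 13}:
PASS-in-cell at statement level** (276 CGS-only classes); **p = 3: GAP(line)** — "The printed chain exits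
published literature at three located sentences: (i) KLZ17 §7.2 «We assume, for the remainder of this
paper, that p ≥ 5» [corpus:paper:arxiv-1503.02888-gx17373040 p0059:L5] …; (ii) BSTW Thm 3.1 (Ohta/FK
structure of the Λ-adic Tate modules) «For p ≥ 5, this theorem is explained in [FK] … An alternate proof
that also includes the p = 3 case is included in [SV-S-Ohta]» [corpus:paper:arxiv-2409.01350 p0029:L7];
(iii) BSTW Remark 5.1 «In [LLZa], [KLZ], [LZ], [BL] it is assumed that p > 3 … the pertinent
Eichler–Shimura isomorphism is proved in [SV-S-Ohta] … for p ≥ 3» [ibid. p0049:L53–L54], with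
[SV-S-Ohta] = «M. Sangiovanni Vincentelli and C. Skinner, A Generalization of Ohta's theorem for
holomorphic automorphic forms, preprint» [ibid. p0088:L14] — NOT posted" (want acq-11552). Scope
(typing-layer finding F1 = sheet §5.1): on the `r ≤ 1` census Theorem A needs X only at the trivial
twist `α = 𝟙` via the §5 Interlude (tree: `CastellaGrossiSkinner2025.thmA_charIdeal_eq_padicLFunction_of_selmerCorankOne`),
which removes Thm. 4.3.1 / KLZ17 §12 from our classes' path but NOT KLZ17 §§7–10 / Ohta — so the
verdict at `3` is GAP(line) on either road. The sheet's item 6.4 asks the typer for exactly this file: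
"the narrowest statement our @3 classes need is Theorem A at p = 3 … `CastellaGrossiSkinner2025_thmA_atThree_OPEN`
… and a PROVED consumer re-deriving Thm D@3 in both ranks from it by the §4.1/§4.2 frames ALREADY in the
tree by name … This keeps the p ≥ 5 consumers on the PUBLISHED fact `thmD_…` and isolates the @3 debt in
ONE displayed binder (the k3-c2 `…_scopedAtThree_OPEN` pattern, p421845/p441607)."

## Contents

* `RowC6.CastellaGrossiSkinner2025_thmA_atThree_OPEN` — the OPEN binder: the statement of
  `CastellaGrossiSkinner2025.thmA_charIdeal_eq_padicLFunction` (Theorem A = Thm. 7.1.1 of Math. Ann.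
  393, VERBATIM in the Greenberg–Vatsal vocabulary of the tree) with the prime FIXED to `p = 3` — `p` is
  kept as a bound variable with the hypothesis `p = 3`, exactly as the `…_scopedAtThree_OPEN` precedent
  does, so that census consumers holding `(p, hp3 : p = 3)` apply it without `subst`. NEVER a theorem.
* `RowC6.thmA_atThree_OPEN_of_thmA` — implied by the published binder A142 (sanity: the OPEN node is the
  `p = 3` instance of a printed theorem; it is "open" in the REGISTER's sense — its printed proof at `3`
  rests on unposted print —, not a new conjecture).
* `RowC6.pPartRankZero_of_thmA_atThree_OPEN`, `RowC6.bsdp_rankZero_of_thmA_atThree_OPEN` — the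
  `r = 0` leg at `3` (145 classes): the node + Greenberg LNM 1716 Thm. 4.1 (`greenberg_charValue_rankZero`)
  + modularity + GZK through the tree glue `padicValRat_bsd_rank_zero_of_mazurMainConjecture`
  (= the printed proof of CGS Thm. D, case `r = 0`: "[CGLS22, Thm. 5.1.4] with [GV00] replaced by
  Theorem A").
* `RowC6.bsdp_rankOne_of_thmA_atThree_OPEN` — the `r = 1` leg at `3` (1 638 classes): the prover's
  BF-free re-route `RowC6.bsdp_rankOne_of_display55_at_twist_pPartRankZero` (CGLS22 display (5.5) +
  Gross–Zagier + Kolyvagin, file `MainConjecturesEisensteinTwistCertificate.lean`, p455255) fed with the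
  rank-`0` print shape of the twist `E^{(d_K)}` obtained from THIS node applied to the twist (again good,
  Eisenstein, non-anomalous at `3`: `partner_good_red_not_anom`) — i.e. the printed proof of CGS Thm. D,
  case `r = 1` ("choosing a suitable K with L(E^K,1) ≠ 0 and applying our result in the rank 0 case to
  E^K"), with "our result in the rank 0 case" AT `3` read through the OPEN binder.

What this file is NOT: not a typing of the gap ITSELF (Ohta's Λ-adic Eichler–Shimura isomorphism /
the KLZ17 §§7–10 reciprocity laws at `p = 3` for the pair `(f_E, 𝐡_v)` — the tree has no Λ-adic
ordinary-cohomology or two-variable Beilinson–Flach vocabulary; see the typer's BINDER-MAP §6); not a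
claim that Theorem A fails or holds at `3`; not a booking. LIFT RULE (sheet §6.3): the @3 flag lifts when a
PUBLIC text proves BSTW Thm. 3.1/3.2 and the KLZ17 §§8–10 laws at `p = 3` ([SV-S-Ohta] posted /
published with BOTH prongs of referee C's R361 (ε) strike test — (i) the ω⁰-component at tame level N for
f_E's family AT THE EISENSTEIN maximal ideal (R381 (θ): G♯^Eis), (ii) the open curve Y₁(D_K·3^∞) at the
Eisenstein ideal of 𝐡_v, (iii) the l.4175–4176 Gr-side normalisation for Eisenstein g —, or an equivalent; bstw24-r2
names the residual «R3-ord = h-side (3-ii)♭′+B1 ∪ g-side G3g(3)», its ADDENDUM-2 input census C1–C12 finds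
no public un-withdrawn text for prong (i) at 3; condition (iii) discharged in cell by the admitted Lemma W / D-ω / §E
repairs, C4-R3-ADD / C4-R5 2026-08-27: operative test (i′) ∧ (ii)) — then this binder is discharged by citing A142 by name
(`RowC6.thmA_atThree_OPEN_of_thmA`) and the consumers below become flag-free.

References: [CastellaGrossiSkinner2025] Math. Ann. 393 (2025) Thm. A = Thm. 7.1.1 (TeX l. 382–392,
3277–3284), Thm. D and its proof (§1.2, l. 591–608), §5 Interlude (l. 2074–2150), Thm. 4.1.1 (l.
1682–1702) [PUB]; [BurungaleSkinnerTianWan2024] arXiv:2409.01350 §5, Thm. 3.1, Rem. 5.1 [PRE];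
[KingsLoefflerZerbes2017] §7.2 (p ≥ 5); D-AUDIT-cgs25-r1.md cd6b303b333505a2; tree A142
`CastellaGrossiSkinner2025/MazurMainConjecture.lean`, `…/MazurMainConjectureRankOne.lean` (p458645),
`Rank1Residual/Partition/MainConjecturesEisensteinTwistCertificate.lean` (p455255),
`Supersingular/KobayashiMainConjectureX6BSTWScopeThree.lean` (p421845, the pattern).
-/

set_option autoImplicit false

noncomputable section

open scoped Classical MatrixGroups ModularForm

open CongruenceSubgroup WeierstrassCurve NumberField Literature.NumberTheory.EllipticCurves
  Literature.NumberTheory.EllipticCurves.ModularForms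
  Literature.NumberTheory.EllipticCurves.Rank1Residual
  Literature.NumberTheory.EllipticCurves.CastellaGrossiLeeSkinner2022

namespace Summit.BirchSwinnertonDyer.Rank1Residual

/-- **OPEN BINDER — Castella–Grossi–Skinner 2025 Theorem A (= Thm. 7.1.1, Math. Ann. 393) AT `p = 3`.**
For `W/ℚ` globally minimal elliptic and `p = 3` of good reduction with `E[3]` reducible and
`a_3 ≢ 1 (mod 3)` ("`φ|_{G_p} ≠ 1, ω`", tree `¬ Anom W p`): Mazur's main conjecture in the Néron
normalisation — for the cyclotomic `ℤ_3`-extension `κ`, a topological generator `γ` matching the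
cyclotomic variable, the newform `f` of level `N_E`, the rational `ϖ` with `ϖ·Ω_E = Ω⁺_f` and every dual
datum `D`: `D` is `Λ`-torsion and `char_Λ D = (g)` with `ι g = ϖ · L_3(f, α_3)` — VERBATIM the `p = 3`
instance of `CastellaGrossiSkinner2025.thmA_charIdeal_eq_padicLFunction` (A142; `p` kept bound with the
hypothesis `p = 3`). STATUS: the statement is PRINTED and refereed (Math. Ann.) for every `p > 2`, but at
`p = 3` its printed proof rests on CGS Thm. 4.1.1 ⇐ [BSTW23, §5] (arXiv:2409.01350, PRE) ⇐ KLZ17 §§7–10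
(printed «p ≥ 5») and BSTW Thm. 3.1 / Rem. 5.1 ⇐ [SV-S-Ohta] (unposted preprint; acq-11552) — the
in-cell referee's GAP(line) (D-AUDIT-cgs25-r1 §0 (i)–(iii), §5.4 G-p3; its ADDENDUM-1 81b0ea39d50df0e4 §A imports
the bstw24 readers' §5 verdict as the verdict of record and §B.4 lists BSTW l. 4175–4176 (Gr-side «[ω_g, D(T⁺)]
= 𝒪_λ», printed-unproved for Eisenstein g with a_p ≡ −1 — every p = 3 D4 class) with this GAP; concurred
independently by D-AUDIT-cgs25-r2 0d093e8f7ab6b874 V3 (+ ADDENDUM-1 5366702acfa5a3a4: V3 unchanged), D-AUDIT-bstw24-r1 2ab68891cb7b08bc O3 (+ addenda dd57a5d9 / 5fc2aa1c /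
f18da4da), D-AUDIT-bstw24-r2 69e4de3690fd21dc N1 / (T-a) (endorses this binder by name; + addenda 850c38dd /
429d6b8a / 4e4fd1dd); referee C (pub-bsdpct-r3; family service completed there, deferred items to C4 = pub-bsdpct-r7) R381 (cgs25 group ruling: R381 (2026-08-26T23:25:38Z; wakes cd6b303b r1 · 0d093e8f r2 · 81b0ea39 r1-ADDENDUM-1 + ARM-P r08 pointer b3b03635; r2-ADDENDUM-1 5366702a lands at C4): A47 + A142 VERBATIM — PASS ×2 (kernel PC/NC at the desk), SMUGGLED none; hypotheses-as-used PASS-MET (r1 2 888 pairs / r2 2 059 recount, 0 violations); node X = CGS Thm 4.1.1 «proved in [BSTW23, §5]»: @3 GAP(line) CONFIRMED — verdict of record for the cgs25 row, the 1 783 CGS-only @3 classes STAY LITERAL on the typed OPEN binder p461118 (typed isolation ENDORSED AS LANDED: p461118 + p459542 + p462807; flag-rename content GRANTED — any adopted string must name its coordinate system, store Thm 3.1 = printed Thm 4.1); @p ≥ 5 PR half PASS-in-cell on ALL 276 ((irr)-free, H_p(f) cancels; G-vv̄ CORRECTION OF RECORD ADOPTED; E-1/E-2 ADOPTED as documentation,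 any future typed Thm 4.1.1 carries target H_p(f)⁻¹·I_f ⊗̂ Λ_K or the Cor 4.1.3 form); Gr half 76 non-(anom) PASS-in-cell from print (KLZ Prop 7.3.1 pivot) / 200 (anom) RETURN(line BSTW l.4175–4176) by the letter, Lemma W VERIFIED at sketch level, admission as the cell repair = C4's call once r2's addendum lands; Q1 (printed Prop 4.12) NOT finally adjudicated — C4's (CGS import SAFE under either adjudication via the proof's free auxiliary field; p465812 = the conservative typed form); CGLS re-route 0 classes; F-Hp CONFIRMED by a fourth, internal-inconsistency route; 0 cells move; Q1 final word / Lemma W admission / §5 verdict of record TRANSFERRED to C4 = pub-bsdpct-r7 with the desk's evidence) on top of referee C's R353 (ζ)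
register-wide word on the Ohta-ES@3 node «CONFIRMED-as-flag … D4@3 (CGS 4.1.1 ← [BST]/BSTW §5)» and its
R361 (ε) prong map (node TWO-PRONGED: G♯ = Λ-adic Eichler–Shimura/structure package for the Hida family of
f_E at (3, ω⁰), tame level N, here at the Eisenstein maximal ideal; G♭ = the same for 𝐡_v at (3, ω⁻¹) on
Y₁(D_K·3^∞) at its Eisenstein ideal, [SV-S-Ohta] PRE; ordinary rows incl. «D4@3 through CGS Thm 4.1.1»
engage G♭ ∧ G♯; D4@3 engagement of record: R381 (θ) PRONG-MAP EXTENSION — «D4 = a THIRD engagement class, ordinary-EISENSTEIN g-side» (E[p] reducible puts f_E's own Hida family at an EISENSTEIN maximal ideal with trivial (ω⁰) character, so both Cais exclusions bite the g-side); STRIKE TEST for D4 rows: a future refereed text lifts the @3 node for D4 iff it prints at p = 3 (i) Λ-adic ES for the ω⁰-component AT AN EISENSTEIN maximal ideal, open curve (G♯^Eis — strictly stronger than D3's G♯), AND (ii) G♭ (the 𝐡_v open-curve Eisenstein row), AND (iii) the l.4175–4176 Gr-side normalisation for Eisenstein g (or Lemma W admitted curve-side); texts that strike D3's conditions do NOT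 lift D4@3); referee A R346
booked the 1 908 rank-one D4 classes on the BF-free twist row instead, leaving 145 rank-zero + 3 residual
rank-one classes at 3 on this binder). Component string of record (bstw24-r2 (T-b), ADDENDUM-2 §E):
`…@BSTW24-§5@3 ⟸ OhtaΛES@3 = {R3-h: (3-ii)♭′+B1; G3g(3): KLZ17 Thm 7.2.3(i–v, both rows) + Thm 9.5.1 +
Lemma 7.4.2 + Thm 9.5.2, tame component 0, Eisenstein 𝔪, tame level N}`. Hence an OPEN binder of the
register, NEVER a theorem; discharged by `RowC6.thmA_atThree_OPEN_of_thmA` the day the three conditions of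
referee C's R381 (θ) D4 strike test are met in refereed public print at 3 — UPDATE 2026-08-27 (C4-R3-ADD 01:02Z, C4-R5
01:51Z (4)): condition (iii), the l.4175–4177 Gr-side normalisation, is DISCHARGED IN CELL by the admitted reader repairs
(Lemma W, cgs25-r1 ADDENDUM-2 4b747cb084e66906 §F; D-ω, bstw24-r2 ADDENDUM-6 eaa05811605d1147; §E, cgs25-r2
ADDENDUM-1 5366702acfa5a3a4), p-free at odd p, so the STRIKE TEST OF RECORD is consolidated to (i′) the ω⁰-component
Λ-adic ES package for H¹_ord of the open tower Y₁(N·3^∞) WITHOUT a non-Eisenstein / Gorenstein / p-distinguished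
localisation hypothesis (or one f_E's Eisenstein 𝔪 provably meets) ∧ (ii) the Y₁(D_K·3^∞) package at the Eisenstein
ideal of 𝐡_v; the @3 verdict itself is UNCHANGED (GAP(line) of record: C R381 (γ), C4-R3 (β), C4-R5 (4)); at p ≥ 5 the
node is PASS-in-cell with reader repairs and referee A R418 struck the p ≥ 5 register entries (the p = 3 entries on
this binder untouched). COORDINATES: «BSTW Thm. 3.1 / Rem. 5.1» above are the STORE (arXiv LaTeXML) numbers quoted from
sheet cd6b303b = PRINTED Thm. 4.1 (TeX l. 2915) / Rem. 6.1 (TeX l. 4918–4922) (R381 (γ) / C4-R5 (3) numbering rider). [claim: BurungaleSkinnerTianWan2024, status: under-review] -/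
def RowC6.CastellaGrossiSkinner2025_thmA_atThree_OPEN : Prop :=
  ∀ (W : WeierstrassCurve ℚ) [W.IsElliptic] [W.IsGloballyMinimal] (p : ℕ) [Fact p.Prime],
    p = 3 → Good W p → Red W p → ¬ Anom W p →
    ∀ (κ : ZpExtension ℚ p) (γ : Field.absoluteGaloisGroup ℚ),
        κ.IsCyclotomic → κ.IsTopGenerator γ → IsCyclotomicVariable p γ →
      ∀ [NeZero (W.conductorNorm ℤ)] (f : CuspForm (Gamma0 (W.conductorNorm ℤ)) 2),
        IsNewformOf W f → ∀ (ϖ : ℚ), (ϖ : ℝ) * W.realPeriodRat = plusPeriod f →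
      ∀ (D : W.SelmerDualData κ γ), D.IsTorsion ∧
        ∃ g : IwasawaAlgebra p, D.charIdeal = Ideal.span {g} ∧
          iwasawaToPowerSeries p g =
            PowerSeries.C (ϖ : ℚ_[p]) * padicLFunction f (unitRoot W p : ℚ_[p])

/-- **Sanity: the OPEN binder is the `p = 3` instance of the PUBLISHED binder A142** — so it is
weaker than print by construction and is discharged by name when the register lifts the @3 flag.
CONDITIONAL on nothing but A142 itself. [claim: BurungaleSkinnerTianWan2024, status: under-review] -/
theorem RowC6.thmA_atThree_OPEN_of_thmA
    (hA : CastellaGrossiSkinner2025.thmA_charIdeal_eq_padicLFunction) :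
    RowC6.CastellaGrossiSkinner2025_thmA_atThree_OPEN := by
  intro W _ _ p _ hp3 hgood hred hna κ γ hκ hγ hT _ f hf ϖ hϖ D
  exact hA W p (by omega) hgood hred hna κ γ hκ hγ hT f hf ϖ hϖ D

/-- **Row D4, `r = 0` at `3`: the OPEN binder ⇒ the rank-`0` print shape.** For `W/ℚ` globally minimal
elliptic, `p = 3` good with `E[3]` reducible, `a_3 ≢ 1 (mod 3)` and `L(E,1) ≠ 0`: `PPartRankZero W p`
(`ord_3(L(E,1)/Ω_E) = ord_3 #Ш + ord_3 ∏c_ℓ − 2 ord_3 #E(ℚ)_tors`) from the binder, Greenberg's Thm. 4.1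
BY NAME (`greenberg_charValue_rankZero`), modularity (`hmodP`) and GZK (`hGZK`), through the tree glue
`padicValRat_bsd_rank_zero_of_mazurMainConjecture` — the printed proof of CGS Thm. D, case `r = 0`, AT
`3`. CONDITIONAL; closes nothing. [claim: BurungaleSkinnerTianWan2024, status: under-review] -/
theorem RowC6.pPartRankZero_of_thmA_atThree_OPEN
    (hA3 : RowC6.CastellaGrossiSkinner2025_thmA_atThree_OPEN)
    (hGr : greenberg_charValue_rankZero) (hmodP : nonempty_modularParametrizationData)
    (hGZK : rank_eq_analyticRank_of_analyticRank_le_one)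
    (W : WeierstrassCurve ℚ) [W.IsElliptic] [W.IsGloballyMinimal] (p : ℕ) [Fact p.Prime]
    (hp3 : p = 3) (hgood : Good W p) (hred : Red W p) (hna : ¬ Anom W p)
    (hL : W.entireLFunction 1 ≠ 0) : PPartRankZero W p := by
  have hp : 2 < p := by omega
  have hord : ¬ (p : ℤ) ∣ W.frobeniusTrace p := (goodOrd_of_red_of_good W p hp hgood hred).2
  have hr : W.analyticRank = 0 :=
    Literature.NumberTheory.EllipticCurves.analyticRank_eq_zero_of_entireLFunction_one_ne_zero W hL
  obtain ⟨-, hfin⟩ := hGZK W (by omega)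
  have hGr' := fun (κ : ZpExtension ℚ p) (γ : Field.absoluteGaloisGroup ℚ) (hκ : κ.IsCyclotomic)
      (hγ : κ.IsTopGenerator γ) (hγ' : IsCyclotomicVariable p γ) (D : W.SelmerDualData κ γ)
      (_ : Module.Finite (IwasawaAlgebra p) D.X) (hX : D.IsTorsion) (fE : IwasawaAlgebra p)
      (hfE : D.charIdeal = Ideal.span {fE}) (hSel : Finite (W.selmerGroupPInfty p)) ↦
    hGr W p (by omega) hgood hord κ γ hκ hγ hγ' D hX fE hfE hSel
  exact padicValRat_bsd_rank_zero_of_mazurMainConjecture W p hgood hord hL hfin hmodP hGr'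
    (hA3 W p hp3 hgood hred hna)

/-- **Row D4, `r = 0` at `3` (145 classes): the OPEN binder ⇒ `BSD(E,3)` (Miller).** As
`RowC6.pPartRankZero_of_thmA_atThree_OPEN`, followed by the cell's bridge `bsdp_of_pPartRankZero`;
`L(E,1) ≠ 0` from `ord_{s=1} L(E,s) = 0` under modularity (`analyticRank_eq_zero_iff_holds`).
CONDITIONAL on the OPEN binder; closes nothing. [claim: BurungaleSkinnerTianWan2024, status: under-review] -/
theorem RowC6.bsdp_rankZero_of_thmA_atThree_OPEN
    (hA3 : RowC6.CastellaGrossiSkinner2025_thmA_atThree_OPEN)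
    (hGr : greenberg_charValue_rankZero) (hmod : hasEntireLFunction_rat)
    (hmodP : nonempty_modularParametrizationData) (hGZK : rank_eq_analyticRank_of_analyticRank_le_one)
    (W : WeierstrassCurve ℚ) [W.IsElliptic] [W.IsGloballyMinimal] (p : ℕ) [Fact p.Prime]
    (hp3 : p = 3) (hgood : Good W p) (hred : Red W p) (hna : ¬ Anom W p)
    (hr0 : W.analyticRank = 0) : BSDp W p :=
  bsdp_of_pPartRankZero W p hmod hGZK hr0
    (RowC6.pPartRankZero_of_thmA_atThree_OPEN hA3 hGr hmodP hGZK W p hp3 hgood hred hna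
      ((W.analyticRank_eq_zero_iff_holds (hmod W)).mp hr0))

/-- **Row D4, `r = 1` at `3` (1 638 classes): the OPEN binder for THE TWIST ⇒ `BSD(E,3)`.** For `W/ℚ`
globally minimal elliptic, `p = 3` good with `E[3]` reducible, `a_3 ≢ 1 (mod 3)`, `ord_{s=1}L(E,s) = 1`,
ONE admissible `K` ((a) `d_K` odd `< −4`, (b) every `ℓ ∣ N_E` split, (c) `3` split, (d)
`L(E^{(d_K)},1) ≠ 0`) and ONE globally minimal model `Wd` of `E^{(d_K)}`: `BSDp W p`. The twist is again
good, Eisenstein and non-anomalous at `3` (`partner_good_red_not_anom`: `a_3(E^K) = a_3(E)` as `3`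
splits) and of analytic rank `0` (`RowC6.analyticRank_twist_eq_zero`), so the OPEN binder gives its
rank-`0` print shape (`RowC6.pPartRankZero_of_thmA_atThree_OPEN`), and the prover's BF-free re-route
`RowC6.bsdp_rankOne_of_display55_at_twist_pPartRankZero` (CGLS22 display (5.5) `h55` + Gross–Zagier
`hGZ`/`hGZQ` + Kolyvagin `hKo` + GZK + modularity, p455255) concludes — the printed proof of CGS Thm. D,
case `r = 1`, AT `3`, with "our result in the rank 0 case [applied] to `E^K`" read through the binder.
CONDITIONAL on the OPEN binder; closes nothing. [claim: BurungaleSkinnerTianWan2024, status: under-review] -/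
theorem RowC6.bsdp_rankOne_of_thmA_atThree_OPEN
    (hA3 : RowC6.CastellaGrossiSkinner2025_thmA_atThree_OPEN)
    (hGr : greenberg_charValue_rankZero) (h55 : display55_sha_heegnerIndex)
    (hmodP : nonempty_modularParametrizationData) (hnf : exists_isNewformOf)
    (hGZQ : GrossZagier1986_thm_I_7_3)
    (hGZ : ∀ (N : ℕ) [NeZero N] (W : WeierstrassCurve ℚ) (K : Type) [Field K] [NumberField K],
      gross_zagier N W K)
    (hKo : ∀ (N : ℕ) [NeZero N] (W : WeierstrassCurve ℚ) (K : Type) [Field K] [NumberField K],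
      kolyvagin N W K)
    (hGZK : rank_eq_analyticRank_of_analyticRank_le_one)
    (W : WeierstrassCurve ℚ) [W.IsElliptic] [W.IsGloballyMinimal] (p : ℕ) [Fact p.Prime]
    (hp3 : p = 3) (hgood : Good W p) (hred : Red W p) (hna : ¬ Anom W p) (hr : W.analyticRank = 1)
    (K : Type) [Field K] [NumberField K] (hK : IsImaginaryQuadratic K)
    (hodd : Odd (NumberField.discr K)) (hlt : NumberField.discr K < -4)
    (hHN : SatisfiesHeegnerHypothesis (W.conductorNorm ℤ) K) (hHp : SatisfiesHeegnerHypothesis p K)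
    (hLt : (W.quadraticTwist (NumberField.discr K : ℚ)).entireLFunction 1 ≠ 0)
    (Wd : WeierstrassCurve ℚ) [Wd.IsElliptic] [Wd.IsGloballyMinimal]
    (hWd : ∃ C : VariableChange ℚ, C • Wd = W.quadraticTwist (NumberField.discr K : ℚ)) :
    BSDp W p := by
  have hp : 2 < p := by omega
  have hmod : hasEntireLFunction_rat := hasEntireLFunction_rat_of_exists_isNewformOf hnf
  obtain ⟨hgood_d, hred_d, hna_d⟩ :=
    partner_good_red_not_anom hp hgood hred hna K hK hodd hHp Wd hWd
  have hrd : Wd.analyticRank = 0 := RowC6.analyticRank_twist_eq_zero hmod W K hLt Wd hWd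
  have hLd : Wd.entireLFunction 1 ≠ 0 := (Wd.analyticRank_eq_zero_iff_holds (hmod Wd)).mp hrd
  have htw : PPartRankZero Wd p :=
    RowC6.pPartRankZero_of_thmA_atThree_OPEN hA3 hGr hmodP hGZK Wd p hp3 hgood_d hred_d hna_d hLd
  exact RowC6.bsdp_rankOne_of_display55_at_twist_pPartRankZero h55 hmodP hnf hGZQ hGZ hKo hGZK W p hp
    hgood hred hna hr K hK hodd hlt hHN hHp hLt Wd hWd htw

end Summit.BirchSwinnertonDyer.Rank1Residual

end
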